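import Literature.MathematicalPhysics.QuantumManyBody.BoseEinsteinCondensation
import Summits.AtomisticToContinuum.BoseEinsteinCondensation.Statement

/-!
# Mode criteria for ground-state BEC (the Penrose–Onsager door)

Conjunct `BoseEinsteinCondensation` of `AtomisticToContinuum`. The audited statement asks for a lower
bound `c N ≤ condensateNumber v N L_N`, `L_N = (N/ρ)^{1/3}`, where `condensateNumber` is the
`δ → 0` limit of the infimum over `δ`-near-minimisers `Ψ` of `λ_max(γ_Ψ) = sup_φ ⟨φ, γ_Ψ φ⟩`.
Every approach in print establishes (on the length scales it reaches) a lower bound on the occupation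
`⟨φ, γ_Ψ φ⟩` of ONE explicit mode — the flat (zero-momentum) mode of the box [LSSY2005, Ch. 5, (5.4);
Thm. 5.1] — uniformly over low-energy states. This file records, sorry-free, the exact form in which such
a bound decides the conjunct:

* `SoloInformed.hasGroundStateBEC_of_maxOccupation` — a uniform lower bound `c N ≤ λ_max(γ_Ψ)` over the
  `δ_N`-near-minimisers, for SOME slack `δ_N > 0` and all large `N`, gives `HasGroundStateBEC v ρ`;
* `SoloInformed.hasGroundStateBEC_of_occupation` — the same with a fixed sequence of normalised measurable
  test modes `φ_N` (the mode may be slowly modulated: the statement's `λ_max` is a supremum over all modes,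
  not the zero-momentum occupation);
* `SoloInformed.lintegral_flatMode_sq` — the flat mode `L^{-3/2} 1_{Λ_L}` is normalised (`volume Λ_L = L³`,
  `SoloInformed.volume_box`),
  and `SoloInformed.hasGroundStateBEC_of_flatOccupation` — the classical Penrose–Onsager / LSSY criterion:
  a uniform lower bound `c N ≤ N₀(Ψ) = ⟨L^{-3/2} 1_{Λ_L}, γ_Ψ L^{-3/2} 1_{Λ_L}⟩ = L⁻³ ∬ γ_Ψ` over
  near-minimisers implies BEC [PenroseOnsager1956; LSSY2005, §1.2 (1.19), Ch. 5 (5.2)–(5.4)];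
* `SoloInformed.boseEinsteinCondensation_of_flatOccupation` — the conjunct from such bounds for every
  admissible `v` at all small densities.

These are doors, not progress on the open core: what remains is the uniform-in-`L` occupation bound itself
(known only for boxes of side `≲ a(ρa³)^{-3/4-η}`, Junge 2026 Cor. 6; Fournais 2020; the thermodynamic
limit is open, LSSY2005 Ch. 5 p. 42).
-/

noncomputable section

open MeasureTheory Filter Set
open scoped ENNReal NNReal

namespace Summit.AtomisticToContinuum.BoseEinsteinCondensation.Theorems

open Literature.MathematicalPhysics.QuantumManyBody.BoseGas

/-- **BEC from a uniform `λ_max` bound.** If for all large `N` there is a slack `δ_N > 0` such that every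
trial state within `δ_N` of the ground-state energy in the box `Λ_{L_N}`, `L_N = (N/ρ)^{1/3}`, has
`λ_max(γ_Ψ) ≥ c N`, then the gas condenses in the ground state at density `ρ` (unfolding of
`condensateNumber`; the form in which BEC is to be proved). [cite: LSSY2005, §1.2 (1.19)] -/
theorem SoloInformed.hasGroundStateBEC_of_maxOccupation (v : ℝ → ℝ≥0∞) (ρ : ℝ) {c : ℝ}
    (hc : 0 < c)
    (h : ∀ᶠ N : ℕ in atTop, ∃ δ : ℝ≥0∞, 0 < δ ∧
      ∀ Ψ : TrialState N (sideLength ρ N),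
        energy v Ψ ≤ groundStateEnergy v N (sideLength ρ N) + δ →
          ENNReal.ofReal (c * N) ≤ maxOccupation N Ψ.ψ) :
    HasGroundStateBEC v ρ := by
  refine ⟨c, hc, h.mono fun N hN => ?_⟩
  obtain ⟨δ, hδ, hN⟩ := hN
  exact le_condensateNumber v hδ hN

/-- **BEC from a uniform occupation bound of test modes.** If `φ_N` are normalised measurable one-particle
modes and, for all large `N`, every `δ_N`-near-minimiser `Ψ` in `Λ_{L_N}` occupies `φ_N` macroscopically,
`⟨φ_N, γ_Ψ φ_N⟩ ≥ c N`, then `HasGroundStateBEC v ρ`. The mode is arbitrary (it may be modulated on the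
scale of the box). [cite: LSSY2005, §1.2 (1.17)–(1.19)] -/
theorem SoloInformed.hasGroundStateBEC_of_occupation (v : ℝ → ℝ≥0∞) (ρ : ℝ) {c : ℝ} (hc : 0 < c)
    (φ : ℕ → Space → ℂ)
    (hφ : ∀ N, AEStronglyMeasurable (φ N) volume ∧ ∫⁻ x, (‖φ N x‖₊ : ℝ≥0∞) ^ 2 = 1)
    (h : ∀ᶠ N : ℕ in atTop, ∃ δ : ℝ≥0∞, 0 < δ ∧
      ∀ Ψ : TrialState N (sideLength ρ N),
        energy v Ψ ≤ groundStateEnergy v N (sideLength ρ N) + δ →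
          ENNReal.ofReal (c * N) ≤ occupation N (φ N) Ψ.ψ) :
    HasGroundStateBEC v ρ := by
  refine SoloInformed.hasGroundStateBEC_of_maxOccupation v ρ hc (h.mono fun N hN => ?_)
  obtain ⟨δ, hδ, hN⟩ := hN
  exact ⟨δ, hδ, fun Ψ hΨ =>
    (hN Ψ hΨ).trans (occupation_le_maxOccupation Ψ.ψ (hφ N).1 (hφ N).2)⟩

/-- The box `Λ_L` is the preimage of the coordinate cube `∏ₖ (0, L)` under the measurable identification
`EuclideanSpace ℝ (Fin 3) ≃ᵐ (Fin 3 → ℝ)`. [folklore] -/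
theorem SoloInformed.box_eq_preimage (L : ℝ) :
    box L = (WithLp.ofLp : Space → (Fin 3 → ℝ)) ⁻¹' Set.pi Set.univ (fun _ => Set.Ioo 0 L) := by
  ext x
  simp only [box, Set.mem_setOf_eq, Set.mem_preimage, Set.mem_pi, Set.mem_univ, forall_const]

/-- `volume Λ_L = L³` for `L ≥ 0`. [folklore] -/
theorem SoloInformed.volume_box {L : ℝ} (hL : 0 ≤ L) :
    volume (box L) = ENNReal.ofReal (L ^ 3) := by
  rw [SoloInformed.box_eq_preimage, (PiLp.volume_preserving_ofLp (Fin 3)).measure_preimage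
    (MeasurableSet.univ_pi fun _ => measurableSet_Ioo).nullMeasurableSet, Real.volume_pi_Ioo]
  simp [ENNReal.ofReal_pow hL]

/-- The flat (zero-momentum, Dirichlet-box-normalised) mode `L^{-3/2} 1_{Λ_L}` is square-normalised:
`∫ |L^{-3/2} 1_{Λ_L}|² = L⁻³ · L³ = 1` (`L > 0`). [cite: LSSY2005, Ch. 5 (5.4)] -/
theorem SoloInformed.lintegral_flatMode_sq {L : ℝ} (hL : 0 < L) :
    ∫⁻ x, (‖(box L).indicator (fun _ => ((Real.sqrt ((L ^ 3)⁻¹) : ℝ) : ℂ)) x‖₊ : ℝ≥0∞) ^ 2 = 1 := by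
  have hmeas : MeasurableSet (box L) := by
    rw [SoloInformed.box_eq_preimage]
    exact (PiLp.continuous_ofLp 2 _).measurable (MeasurableSet.univ_pi fun _ => measurableSet_Ioo)
  have hκ : 0 ≤ (L ^ 3)⁻¹ := inv_nonneg.2 (pow_nonneg hL.le 3)
  have hval : (‖((Real.sqrt ((L ^ 3)⁻¹) : ℝ) : ℂ)‖₊ : ℝ≥0∞) ^ 2 = ENNReal.ofReal ((L ^ 3)⁻¹) := by
    rw [← enorm_eq_nnnorm, ← ofReal_norm, ← ENNReal.ofReal_pow (norm_nonneg _), Complex.norm_real,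
      Real.norm_of_nonneg (Real.sqrt_nonneg _), Real.sq_sqrt hκ]
  have hpt : ∀ x, (‖(box L).indicator (fun _ => ((Real.sqrt ((L ^ 3)⁻¹) : ℝ) : ℂ)) x‖₊ : ℝ≥0∞) ^ 2 =
      (box L).indicator (fun _ => ENNReal.ofReal ((L ^ 3)⁻¹)) x := by
    intro x
    by_cases hx : x ∈ box L
    · simp only [Set.indicator_of_mem hx, hval]
    · simp [hx]
  simp_rw [hpt]
  rw [lintegral_indicator_const hmeas, SoloInformed.volume_box hL.le,
    ← ENNReal.ofReal_mul hκ, inv_mul_cancel₀ (pow_ne_zero 3 hL.ne'), ENNReal.ofReal_one]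

/-- The flat mode is (a.e. strongly) measurable. [folklore] -/
theorem SoloInformed.aestronglyMeasurable_flatMode (L : ℝ) :
    AEStronglyMeasurable ((box L).indicator (fun _ => ((Real.sqrt ((L ^ 3)⁻¹) : ℝ) : ℂ))) volume := by
  refine aestronglyMeasurable_const.indicator ?_
  rw [SoloInformed.box_eq_preimage]
  exact (PiLp.continuous_ofLp 2 _).measurable (MeasurableSet.univ_pi fun _ => measurableSet_Ioo)

/-- **Penrose–Onsager / LSSY criterion (flat mode).** Write `N₀(Ψ) = ⟨L^{-3/2}1_{Λ_L}, γ_Ψ L^{-3/2}1_{Λ_L}⟩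
= L⁻³ ∬ γ_Ψ(x, x') dx dx'` for the zero-momentum occupation. If for all large `N` there is `δ_N > 0` with
`N₀(Ψ) ≥ c N` for every `δ_N`-near-minimiser `Ψ` in `Λ_{L_N}`, `L_N = (N/ρ)^{1/3}`, then the ground state
condenses at density `ρ`. This is the form of LSSY's (5.4) (there on GP-scale boxes) that would be needed
uniformly in the volume. [cite: LSSY2005, Ch. 5 (5.2)–(5.4)] -/
theorem SoloInformed.hasGroundStateBEC_of_flatOccupation (v : ℝ → ℝ≥0∞) {ρ : ℝ} (hρ : 0 < ρ)
    {c : ℝ} (hc : 0 < c)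
    (h : ∀ᶠ N : ℕ in atTop, ∃ δ : ℝ≥0∞, 0 < δ ∧
      ∀ Ψ : TrialState N (sideLength ρ N),
        energy v Ψ ≤ groundStateEnergy v N (sideLength ρ N) + δ →
          ENNReal.ofReal (c * N) ≤ occupation N
            ((box (sideLength ρ N)).indicator
              (fun _ => ((Real.sqrt ((sideLength ρ N ^ 3)⁻¹) : ℝ) : ℂ))) Ψ.ψ) :
    HasGroundStateBEC v ρ := by
  refine SoloInformed.hasGroundStateBEC_of_maxOccupation v ρ hc
    ((h.and (eventually_gt_atTop 0)).mono fun N hN => ?_)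
  obtain ⟨⟨δ, hδ, hN⟩, hN0⟩ := hN
  exact ⟨δ, hδ, fun Ψ hΨ => (hN Ψ hΨ).trans
    (occupation_le_maxOccupation Ψ.ψ (SoloInformed.aestronglyMeasurable_flatMode _)
      (SoloInformed.lintegral_flatMode_sq
        (show 0 < sideLength ρ N from Real.rpow_pos_of_pos (div_pos (Nat.cast_pos.2 hN0) hρ) _)))⟩

/-- **The conjunct from uniform zero-momentum occupation.** If for every repulsive finite-range `v` there
is `ρ₀ > 0` such that at every density `ρ ∈ (0, ρ₀)` the near-ground states in `Λ_{(N/ρ)^{1/3}}` have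
zero-momentum occupation `≥ c(ρ) N` for all large `N`, then `BoseEinsteinCondensation` holds. The
hypothesis is exactly what is open in the thermodynamic limit (known on boxes of side
`≲ a(ρa³)^{-3/4-η}` only). [cite: LSSY2005, §1.2 (1.19) and Ch. 5 (5.1)–(5.4)] -/
theorem SoloInformed.boseEinsteinCondensation_of_flatOccupation
    (H : ∀ v : ℝ → ℝ≥0∞, IsRepulsiveFiniteRange v →
      ∃ ρ₀ : ℝ, 0 < ρ₀ ∧ ∀ ρ : ℝ, 0 < ρ → ρ < ρ₀ → ∃ c : ℝ, 0 < c ∧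
        ∀ᶠ N : ℕ in atTop, ∃ δ : ℝ≥0∞, 0 < δ ∧
          ∀ Ψ : TrialState N (sideLength ρ N),
            energy v Ψ ≤ groundStateEnergy v N (sideLength ρ N) + δ →
              ENNReal.ofReal (c * N) ≤ occupation N
                ((box (sideLength ρ N)).indicator
                  (fun _ => ((Real.sqrt ((sideLength ρ N ^ 3)⁻¹) : ℝ) : ℂ))) Ψ.ψ) :
    _root_.BoseEinsteinCondensation := by
  intro v hv
  obtain ⟨ρ₀, hρ₀, hρ⟩ := H v hv
  refine ⟨ρ₀, hρ₀, fun ρ h0 h1 => ?_⟩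
  obtain ⟨c, hc, h⟩ := hρ ρ h0 h1
  exact SoloInformed.hasGroundStateBEC_of_flatOccupation v h0 hc h

end Summit.AtomisticToContinuum.BoseEinsteinCondensation.Theorems

end
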